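import Summits.MatrixMultiplication.OmegaCensus.SmallFormats.RankOnePlaneCapGaugeFreeBlock
import HarnessLib

/-!
# ω-census family (a): the residual group of the v1.2 gauge in the 'LINE' position — tail normal form

Cell `pub-omega` (unit `pub-omega-eng1`, gen 33), topic `Summits/MatrixMultiplication/OmegaCensus`
(sub-folder `SmallFormats`). Framing (verbatim): lottery ticket; floor = certified bounds/negative
ranges. HONEST FRAMING: bookkeeping for the gauge-SAT encoders of the `𝔽₃` `⟨2,2,5⟩@17` X-marginal
census (asked for by tensor g31, 2026-08-28: the 'line' half of kitjob-gs's `JOB_NORM3` had no tree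
counterpart). In the 'line' position of `gauge_normal_form_v12` (`R₁`-outputs in `⟨e₀,e₁⟩`,
`R₂`-outputs in `⟨e₀,e₂⟩`) the two TAIL columns `3,4` are free; the residual group contains every
basis change of `k⁵` fixing `e₀, e₁, e₂` (the matrices `[[I₃,0],[X,Y]]`, `X ∈ k^{2×3}`, `Y ∈ GL₂`),
which keeps the X-forms, every output row with zero tail (all `R₁`/`R₂` outputs and the head),
and the Y-forms on matrices with vanishing columns `3,4` (so columns `0,1,2` of every `G_i` and all
`θᵀG_i` conditions of the line position). Choosing the basis `(e₀,e₁,e₂, pivot rows, …)` gives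

**`lineTail_normal_form`** (any field, two output rows, any `m`, terms in a linear order): EITHER
every output row has zero tail, OR for the first term `i₁` with a nonzero tail (all earlier terms:
zero tails) one of (LT2) `W_{i₁} = [[0,0,0,1,0],[0,0,0,0,1]]`; (LT1) `W_{i₁}[0] = (0,0,0,1,0)`,
`W_{i₁}[1][4] = 0` (so `W_{i₁}[1] = (a,b,c,d,0)`); (LT1′) `W_{i₁}[0]` has zero tail and
`W_{i₁}[1] = (0,0,0,1,0)`. Over `𝔽₃`, splitting (LT1) by the trit `d` gives the six tail forms
`0 / (e₀;0) / (e₀;e₀) / (e₀;2e₀) / (0;e₀) / I` of the encoder's list. Not a bound on any rank, not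
progress on `ω`.
-/

namespace Summit.MatrixMultiplication.OmegaCensus.RankOnePlaneCapGeneral

open Module Matrix Literature.Computability.AlgebraicComplexity

variable {k : Type*} [Field k] {c m : ℕ} {ι : Type*} [Fintype ι]

/-- Rows with zero tail (`x₃ = x₄ = 0`) have themselves as coordinates in a basis starting with
`e₀, e₁, e₂`. -/
theorem repr_eq_self_of_tailZero (b : Basis (Fin 5) k (Fin 5 → k)) (hb0 : b 0 = Pi.single 0 1)
    (hb1 : b 1 = Pi.single 1 1) (hb2 : b 2 = Pi.single 2 1) {x : Fin 5 → k} (h3 : x 3 = 0)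
    (h4 : x 4 = 0) : ∀ j, b.repr x j = x j := by
  have hx : x = x 0 • b 0 + x 1 • b 1 + x 2 • b 2 := by
    funext ν; rw [hb0, hb1, hb2]; fin_cases ν <;> simp [h3, h4]
  have hrepr : b.repr x = x 0 • Finsupp.single 0 1 + x 1 • Finsupp.single 1 1 +
      x 2 • Finsupp.single 2 1 := by
    conv_lhs => rw [hx]
    rw [map_add, map_add, map_smul, map_smul, map_smul, b.repr_self, b.repr_self, b.repr_self]
  intro j
  rw [hrepr]
  fin_cases j <;> simp [h3, h4]

/-- **Basis transform fixing `⟨e₀,e₁,e₂⟩`.** For a basis `b` of `k⁵` with `bⱼ = eⱼ` (`j ≤ 2`), a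
computation of `⟨c,m,5⟩` yields one with the SAME X-forms whose output rows are the
`b`-coordinates of the old ones (rows with zero tail unchanged) and whose Y-forms agree with the old
ones on every `Y` with vanishing columns `3,4`. -/
theorem exists_basisTransform3 (β : BilinComp (mulBilin k c m 5) ι) (b : Basis (Fin 5) k (Fin 5 → k))
    (hb0 : b 0 = Pi.single 0 1) (hb1 : b 1 = Pi.single 1 1) (hb2 : b 2 = Pi.single 2 1) :
    ∃ β' : BilinComp (mulBilin k c m 5) ι,
      (∀ i, β'.f i = β.f i) ∧
      (∀ i (Y : Matrix (Fin m) (Fin 5) k), (∀ μ, Y μ 3 = 0 ∧ Y μ 4 = 0) → β'.g i Y = β.g i Y) ∧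
      (∀ i κ j, β'.w i κ j = b.repr (β.w i κ) j) ∧
      (∀ i κ, β.w i κ 3 = 0 ∧ β.w i κ 4 = 0 → β'.w i κ = β.w i κ) := by
  obtain ⟨A, A', hAA', -, hcoord, hrow⟩ := exists_coordMatrices_repr (m := m) b
  obtain ⟨β', hf, hg, hw⟩ := exists_colTransform β A A' hAA'
  have hw' : ∀ i κ j, β'.w i κ j = b.repr (β.w i κ) j := fun i κ j => by
    rw [hw]; exact hcoord (β.w i κ) j
  refine ⟨β', hf, fun i Y hY => ?_, hw', fun i κ h => ?_⟩
  · rw [hg]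
    congr 1
    ext μ ν
    rw [hrow Y μ]
    obtain ⟨h3, h4⟩ := hY μ
    simp only [Fin.sum_univ_five, h3, h4, zero_smul, add_zero, hb0, hb1, hb2]
    fin_cases ν
    · simp
    · simp
    · simp
    · simpa using h3.symm
    · simpa using h4.symm
  · funext j
    rw [hw']
    exact repr_eq_self_of_tailZero b hb0 hb1 hb2 h.1 h.2 j

/-- `e₂, e₁, e₀` are linearly independent in `k⁵`. -/
theorem linearIndependent_e2_e1_e0 :
    LinearIndependent k ![(Pi.single 2 1 : Fin 5 → k), Pi.single 1 1, Pi.single 0 1] := by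
  rw [Fintype.linearIndependent_iff]
  intro g hg i
  have h0 := congrFun hg 0
  have h1 := congrFun hg 1
  have h2 := congrFun hg 2
  simp [Fin.sum_univ_three] at h0 h1 h2
  fin_cases i
  · exact h2
  · exact h1
  · exact h0

/-- A vector in the span of `e₂, e₁, e₀` has zero tail. -/
theorem tailZero_of_mem_span_e2_e1_e0 {x : Fin 5 → k}
    (hx : x ∈ Submodule.span k
      (Set.range ![(Pi.single 2 1 : Fin 5 → k), Pi.single 1 1, Pi.single 0 1])) :
    x 3 = 0 ∧ x 4 = 0 := by
  obtain ⟨cf, rfl⟩ := (Submodule.mem_span_range_iff_exists_fun k).mp hx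
  simp [Fin.sum_univ_three]

/-! ### The tail normal form of the 'line' position -/

/-- **Line-tail normal form** (residual group of the 'line' position; any field, two output rows,
any `m`, terms in a linear order). See the module doc-string: EITHER every output row has zero tail
(columns `3,4`), OR the first term `i₁` with a nonzero tail is brought to (LT2), (LT1) or (LT1′) by a
transform keeping the X-forms, every zero-tail row, and the Y-forms on matrices with vanishing
columns `3,4`. -/
theorem lineTail_normal_form [LinearOrder ι] (β : BilinComp (mulBilin k 2 m 5) ι) :
    ∃ β' : BilinComp (mulBilin k 2 m 5) ι,
      (∀ i, β'.f i = β.f i) ∧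
      (∀ i (Y : Matrix (Fin m) (Fin 5) k), (∀ μ, Y μ 3 = 0 ∧ Y μ 4 = 0) → β'.g i Y = β.g i Y) ∧
      (∀ i κ, β.w i κ 3 = 0 ∧ β.w i κ 4 = 0 → β'.w i κ = β.w i κ) ∧
      ((∀ i κ, β'.w i κ 3 = 0 ∧ β'.w i κ 4 = 0) ∨
        ∃ i₁, (∀ i, i < i₁ → ∀ κ, β'.w i κ 3 = 0 ∧ β'.w i κ 4 = 0) ∧
          ((β'.w i₁ 0 = Pi.single 3 1 ∧ β'.w i₁ 1 = Pi.single 4 1) ∨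
           (β'.w i₁ 0 = Pi.single 3 1 ∧ β'.w i₁ 1 4 = 0) ∨
           ((β'.w i₁ 0 3 = 0 ∧ β'.w i₁ 0 4 = 0) ∧ β'.w i₁ 1 = Pi.single 3 1))) := by
  classical
  by_cases hall : ∀ i κ, β.w i κ 3 = 0 ∧ β.w i κ 4 = 0
  · exact ⟨β, fun _ => rfl, fun _ _ _ => rfl, fun _ _ _ => rfl, Or.inl hall⟩
  push Not at hall
  set T : Finset ι := Finset.univ.filter fun i => ∃ κ, ¬(β.w i κ 3 = 0 ∧ β.w i κ 4 = 0) with hTdef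
  have hT : T.Nonempty := by
    obtain ⟨i, κ, h⟩ := hall
    exact ⟨i, Finset.mem_filter.mpr ⟨Finset.mem_univ _, κ, fun h' => h h'.1 h'.2⟩⟩
  set i₁ := T.min' hT with hi₁def
  have hi₁T : ∃ κ, ¬(β.w i₁ κ 3 = 0 ∧ β.w i₁ κ 4 = 0) :=
    (Finset.mem_filter.mp (Finset.min'_mem T hT)).2
  have hbefore : ∀ i, i < i₁ → ∀ κ, β.w i κ 3 = 0 ∧ β.w i κ 4 = 0 := by
    intro i hi κ
    by_contra h
    have hiT : i ∈ T := Finset.mem_filter.mpr ⟨Finset.mem_univ _, κ, h⟩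
    exact absurd hi (not_lt.mpr (Finset.min'_le T i hiT))
  have hcard : Fintype.card (Fin 5) = finrank k (Fin 5 → k) := by simp
  have key : ∀ (v : Fin 5 → Fin 5 → k), LinearIndependent k v →
      v 2 = Pi.single 2 1 → v 3 = Pi.single 1 1 → v 4 = Pi.single 0 1 →
      ∃ (b : Basis (Fin 5) k (Fin 5 → k)) (β' : BilinComp (mulBilin k 2 m 5) ι),
        (∀ i, b i = v (Fin.rev i)) ∧
        (∀ i, β'.f i = β.f i) ∧
        (∀ i (Y : Matrix (Fin m) (Fin 5) k), (∀ μ, Y μ 3 = 0 ∧ Y μ 4 = 0) →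
          β'.g i Y = β.g i Y) ∧
        (∀ i κ j, β'.w i κ j = b.repr (β.w i κ) j) ∧
        (∀ i κ, β.w i κ 3 = 0 ∧ β.w i κ 4 = 0 → β'.w i κ = β.w i κ) := by
    intro v hli h2 h3 h4
    let b₀ := basisOfLinearIndependentOfCardEqFinrank hli hcard
    have hb₀ : ⇑b₀ = v := coe_basisOfLinearIndependentOfCardEqFinrank hli hcard
    let b := b₀.reindex Fin.revPerm
    have hb : ∀ i, b i = v (Fin.rev i) := fun i => by
      rw [Basis.reindex_apply, Fin.revPerm_symm, Fin.revPerm_apply, hb₀]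
    have hb0 : b 0 = Pi.single 0 1 := by rw [hb]; exact h4
    have hb1 : b 1 = Pi.single 1 1 := by rw [hb]; exact h3
    have hb2 : b 2 = Pi.single 2 1 := by rw [hb]; exact h2
    obtain ⟨β', hf, hg, hw, hrow⟩ := exists_basisTransform3 β b hb0 hb1 hb2
    exact ⟨b, β', hb, hf, hg, hw, hrow⟩
  have hbefore' : ∀ {β' : BilinComp (mulBilin k 2 m 5) ι},
      (∀ i κ, β.w i κ 3 = 0 ∧ β.w i κ 4 = 0 → β'.w i κ = β.w i κ) →
      ∀ i, i < i₁ → ∀ κ, β'.w i κ 3 = 0 ∧ β'.w i κ 4 = 0 := by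
    intro β' hrow i hi κ
    rw [hrow i κ (hbefore i hi κ)]; exact hbefore i hi κ
  have hli3 := linearIndependent_e2_e1_e0 (k := k)
  by_cases h0 : β.w i₁ 0 3 = 0 ∧ β.w i₁ 0 4 = 0
  · -- (LT1′): row 0 has zero tail, so row 1 has not
    have h1 : ¬(β.w i₁ 1 3 = 0 ∧ β.w i₁ 1 4 = 0) := by
      obtain ⟨κ, hκ⟩ := hi₁T
      fin_cases κ
      · exact absurd h0 hκ
      · exact hκ
    have hr1 : β.w i₁ 1 ∉ Submodule.span k (Set.range ![(Pi.single 2 1 : Fin 5 → k),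
        Pi.single 1 1, Pi.single 0 1]) := fun h => h1 (tailZero_of_mem_span_e2_e1_e0 h)
    have hli4 : LinearIndependent k ![β.w i₁ 1, Pi.single 2 1, Pi.single 1 1, Pi.single 0 1] :=
      LinearIndependent.finCons hli3 hr1
    obtain ⟨x, hx⟩ := exists_not_mem_span_fin5 (by norm_num) hli4
    have hli5 : LinearIndependent k ![x, β.w i₁ 1, Pi.single 2 1, Pi.single 1 1, Pi.single 0 1] :=
      LinearIndependent.finCons hli4 hx
    obtain ⟨b, β', hb, hf, hg, hw, hrow⟩ := key _ hli5 rfl rfl rfl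
    have hb3 : b 3 = β.w i₁ 1 := by rw [hb]; rfl
    refine ⟨β', hf, hg, hrow, Or.inr ⟨i₁, hbefore' hrow, Or.inr (Or.inr ⟨?_, ?_⟩)⟩⟩
    · rw [hrow i₁ 0 h0]; exact h0
    · rw [show β'.w i₁ 1 = fun j => b.repr (b 3) j from by funext j; rw [hw, hb3]]
      exact repr_basis_eq_single b 3
  · -- row 0 has a nonzero tail
    have hr0 : β.w i₁ 0 ∉ Submodule.span k (Set.range ![(Pi.single 2 1 : Fin 5 → k),
        Pi.single 1 1, Pi.single 0 1]) := fun h => h0 (tailZero_of_mem_span_e2_e1_e0 h)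
    have hli4 : LinearIndependent k ![β.w i₁ 0, Pi.single 2 1, Pi.single 1 1, Pi.single 0 1] :=
      LinearIndependent.finCons hli3 hr0
    by_cases h1 : β.w i₁ 1 ∈ Submodule.span k (Set.range ![β.w i₁ 0, (Pi.single 2 1 : Fin 5 → k),
        Pi.single 1 1, Pi.single 0 1])
    · -- (LT1): row 1 depends on `e₀, e₁, e₂, row 0`
      obtain ⟨x, hx⟩ := exists_not_mem_span_fin5 (by norm_num) hli4
      have hli5 : LinearIndependent k ![x, β.w i₁ 0, Pi.single 2 1, Pi.single 1 1, Pi.single 0 1] :=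
        LinearIndependent.finCons hli4 hx
      obtain ⟨b, β', hb, hf, hg, hw, hrow⟩ := key _ hli5 rfl rfl rfl
      have hb3 : b 3 = β.w i₁ 0 := by rw [hb]; rfl
      have hb2 : b 2 = Pi.single 2 1 := by rw [hb]; rfl
      have hb1 : b 1 = Pi.single 1 1 := by rw [hb]; rfl
      have hb0 : b 0 = Pi.single 0 1 := by rw [hb]; rfl
      obtain ⟨cf, hcf⟩ := (Submodule.mem_span_range_iff_exists_fun k).mp h1
      have hrepr1 : b.repr (β.w i₁ 1) = cf 0 • Finsupp.single 3 1 + cf 1 • Finsupp.single 2 1 +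
          cf 2 • Finsupp.single 1 1 + cf 3 • Finsupp.single 0 1 := by
        rw [← hcf, Fin.sum_univ_four]
        simp only [Matrix.cons_val_zero, Matrix.cons_val_one, Matrix.cons_val_two,
          Matrix.cons_val_three, Matrix.tail_cons, Matrix.head_cons, map_add, map_smul]
        rw [← hb3, ← hb2, ← hb1, ← hb0, b.repr_self, b.repr_self, b.repr_self, b.repr_self]
      refine ⟨β', hf, hg, hrow, Or.inr ⟨i₁, hbefore' hrow, Or.inr (Or.inl ⟨?_, ?_⟩)⟩⟩
      · rw [show β'.w i₁ 0 = fun j => b.repr (b 3) j from by funext j; rw [hw, hb3]]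
        exact repr_basis_eq_single b 3
      · rw [hw, hrepr1]; simp
    · -- (LT2): rows 0, 1 independent modulo `⟨e₀,e₁,e₂⟩`
      have hli5 : LinearIndependent k
          ![β.w i₁ 1, β.w i₁ 0, Pi.single 2 1, Pi.single 1 1, Pi.single 0 1] :=
        LinearIndependent.finCons hli4 h1
      obtain ⟨b, β', hb, hf, hg, hw, hrow⟩ := key _ hli5 rfl rfl rfl
      have hb3 : b 3 = β.w i₁ 0 := by rw [hb]; rfl
      have hb4 : b 4 = β.w i₁ 1 := by rw [hb]; rfl
      refine ⟨β', hf, hg, hrow, Or.inr ⟨i₁, hbefore' hrow, Or.inl ⟨?_, ?_⟩⟩⟩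
      · rw [show β'.w i₁ 0 = fun j => b.repr (b 3) j from by funext j; rw [hw, hb3]]
        exact repr_basis_eq_single b 3
      · rw [show β'.w i₁ 1 = fun j => b.repr (b 4) j from by funext j; rw [hw, hb4]]
        exact repr_basis_eq_single b 4

end Summit.MatrixMultiplication.OmegaCensus.RankOnePlaneCapGeneral
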